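import Summits.QuantumFields.YangMills.Theorems.AlphaInputsT3ACv3InClassSelXsOfNestedRegular
import Summits.QuantumFields.YangMills.Theorems.AlphaInputsT3ACv3RegionalThm1CarrierBridge
import HarnessLib

/-!
# `AlphaInputsT3ACv3NestedRegularGlobalClause` — HAZARD «V4-VORTEX» MADE CHECKABLE BY NAME: clause (2) of the B1 display `NestedRegularSelT3` at level `i = 0` is GLOBAL
# smallness of every fine plaquette of the selected configuration (`Ω₀(h) = T_η` for every history), and so is clause 1 of (2) in the regional carrier `RegOnT3` — cell
# `ym3-torus`, crux stmt-QuantumFields-19936 (`HistoryTailL`), width seat `ym-ust-19936-w6` (g3); ★★OWNER RULING g26-№23 (b), LEAD ★w1-19936 g3 09:44:28Z (b)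

WHY.  The seat's LOCATE (19936 evidence #49, `ym-ust-19936-w6/g3/LOCATE-nested-vortex-w6g3.md`): the displayed supplier predicate `AlphaInputsT3AC.NestedRegularSelT3` (EDGES-A∕B target of
the B1 plan, ✓ `…v3InClassSelXsOfNestedRegular`) asks, at every admissible non-trivial history and EVERY datum `W`, for radii `α` in the record's windows with (2) «every fine plaquette
with four corners in `Ω_i(h)` within `α_i·L^{−2i}`, `i ≤ k`» and (3ᵗ) «exact `k`-fold `ℰp`-averages `W` on the bonds of `Ω_k(h)` when `W` is charged».  Since `Ω₀(h)` is the WHOLE torus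
(`Omega_zero_eq_univ`), (2) at `i = 0` is `PlaqSmall α₀ (UkH k h W)` GLOBALLY with `α₀ ≤ C68·θ(K) → 0`, whereas `ChargedT3` constrains only the four-corner plaquettes of `Ω_k(h)`: a charged
datum with holonomy `−1` around a recorded tube (the ℤ₂-vortex of the memo) then contradicts (3ᵗ) by lattice Stokes — the display is unsatisfiable for `K ≥ K₀`, its doors vacuous
(the stub `AlphaInputsT3ACv4RecChi` and the seam-blind Sel∕Xs displays are NOT affected: they never read the shell `∂Ω_k(h)`).  THIS FILE records the two kernel facts behind the
mechanism, so that the vacuity is checkable by name; the Stokes∕asymptotic half stays in the memo (★★OWNER: full `Negative/` file on HOLD).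
WHAT (def-free).  §1 `plaqsIn 0 (Ω₀(h))` is every fine plaquette; `PlaqSmallOn` there is `PlaqSmall`.  §2 ★ `AlphaInputsT3AC.plaqSmall_of_nestedRegularSel`: from `NestedRegularSelT3 K Ut UkH`,
at every admissible non-trivial `(k, h)` and every `W`, a radius `0 < α₀ ≤ C68·θBal(K)` inside the [Balaban1985Averaging] Prop 2 window with `PlaqSmall α₀ (UkH k h W)` on ALL of `T_η`
together with the top clause (3ᵗ) — the two conjuncts the vortex datum plays against each other.  §3 `AlphaInputsT3AC.plaqSmall_of_regOnT3`: the regional carrier's clause 1 of (2)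
(`RegOnT3 k h e U`, ✓ `…v3RegionalThm1Carrier`) is likewise GLOBAL `e`-smallness — consistent with print only because print's variational domain is `Ω₀ ⊊ T_η`
([Balaban1985UV3] p.257 «we can take a neighbourhood Ω₀ such that Ω₀∖Ω₁ is a union of big blocks with distances to Ω₁ ≤ R₁M₁», (42) p.266 «Λ₀ = Ω₁ᶜ»; [Balaban1985Variational] p.278:
configurations «on Ω₀», action (5) summed over `p ⊂ Ω₀`), recorded here for the B1 re-cut (LEAD (R2)).
HONEST FRAMING.  Unfoldings of displayed HYPOTHESIS SCHEMAS; nothing of [Balaban1985UV3]∕[Balaban1985Variational] is asserted or refuted in the kernel here; the stub 2′χ-v4, the crux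
`HistoryTailL` and any gap are NOT claimed; count-neutral helper (`--supports stmt-QuantumFields-19936`); registry untouched.  YM₃ on the three-torus is rung R3 of the programme, NOT
the Clay problem: nothing here bears on d = 4, infinite volume, or a mass gap.

References: T. Bałaban, Commun. Math. Phys. 102 (1985) 255–275 [Balaban1985UV3] ((38)–(42) p.266, p.257); Commun. Math. Phys. 102 (1985) 277–309 [Balaban1985Variational]
((2), (5), (7) p.278); Commun. Math. Phys. 98 (1985) 17–51 [Balaban1985Averaging] (Prop 2 (52)–(54) p.26).
-/

set_option autoImplicit false

noncomputable section

namespace Summit.QuantumFields.YangMills.Theorems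

open MeasureTheory Set
open scoped Matrix.Norms.L2Operator
open Literature.MathematicalPhysics.QuantumFieldTheory.Balaban1983to89
open Literature.MathematicalPhysics.QuantumFieldTheory.Balaban1983to89.T3ContinuumYM3Torus
open Literature.MathematicalPhysics.QuantumFieldTheory.Balaban1983to89.T3UnitLawDensityEML (ℰp)
open Literature.MathematicalPhysics.QuantumFieldTheory.Balaban1983to89.T3UnitScaleTilt (θBal)
open Literature.MathematicalPhysics.QuantumFieldTheory.Balaban1983to89.ExpMeanLog (deltaSU)
open Literature.MathematicalPhysics.QuantumFieldTheory.Balaban1983to89.B10Eq38TorusDomains (plaqsIn mem_plaqsIn_iff cornerSet)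
open Literature.MathematicalPhysics.QuantumFieldTheory.Balaban1983to89.B10Eq42TorusConstraint (bondsIn)
open Literature.MathematicalPhysics.QuantumFieldTheory.Balaban1985CMP102.Setting
open Summit.QuantumFields.Balaban3D.Carriers
open Summit.QuantumFields.Balaban3D.Proofs.Primitives (AlphaConsts)

/-! ## §1 At level `0` the region is the whole torus: `plaqsIn 0 (Ω₀(h))` is every fine plaquette -/

section LevelZero

variable {P : Params} {G : Type*} [GaugeGroup G] (M₁ : ℕ) (Rcol : ℕ → ℕ)

/-- **EVERY FINE PLAQUETTE LIES IN `plaqsIn 0 (Ω₀(h))`** — `Ω₀(h) = T_η` at every step and `plaqsIn` asks only that the four corners lie in the region.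
[cite: Balaban1985UV3, (38)–(42) p.266] -/
theorem AlphaInputsT3AC.mem_plaqsIn_Omega_zero {k : ℕ} (h : Hist P k) (q : Plaq P 0) : q ∈ plaqsIn 0 (Omega M₁ Rcol k h 0) := by
  rw [mem_plaqsIn_iff, Omega_zero_eq_univ M₁ Rcol k h]
  exact subset_univ _

/-- **SMALLNESS ON `plaqsIn 0 (Ω₀(h))` IS GLOBAL SMALLNESS**: `PlaqSmallOn (plaqsIn 0 (Ω₀(h))) δ U ↔ PlaqSmall δ U`. [cite: Balaban1985UV3, (38)–(42) p.266] -/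
theorem AlphaInputsT3AC.plaqSmallOn_Omega_zero_iff {k : ℕ} (h : Hist P k) (δ : ℝ) (U : GaugeField P 0 G) :
    PlaqSmallOn (↑(plaqsIn 0 (Omega M₁ Rcol k h 0)) : Set (Plaq P 0)) δ U ↔ PlaqSmall δ U :=
  ⟨fun hU q => hU q (Finset.mem_coe.mpr (AlphaInputsT3AC.mem_plaqsIn_Omega_zero M₁ Rcol h q)), fun hU q _ => hU q⟩

end LevelZero

/-! ## §2 Clause (2) of `NestedRegularSelT3` at `i = 0` is global `α₀`-smallness, next to the top clause (3ᵗ) -/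

section Nested

variable {F : T3Family} {𝔠 : AlphaConsts F.L (suGroupModel 2).N} {γ : ℝ} {hγ : 0 < γ} {hγ1 : γ ≤ (min 𝔠.gamma0 1) ^ 2} {K : ℕ}

/-- ★ **THE TWO CONJUNCTS THE VORTEX DATUM PLAYS AGAINST EACH OTHER.**  From the displayed `NestedRegularSelT3 K Ut UkH`: at every admissible non-trivial history `h` of level `k ≤ K` and
EVERY datum `W` there is a radius `α₀` with `0 < α₀`, `α₀ ≤ C68·θBal(K)` (window (w3) — exponentially small in `K` at fixed record and coupling), the [Balaban1985Averaging] Prop 2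
smallness `143·(7²∕4)²·(L²α₀) ≤ ⅓` (window (w2)), **`PlaqSmall α₀ (UkH k h W)` on the WHOLE torus** (clause (2) at `i = 0`, `Ω₀(h) = T_η`), and the top clause (3ᵗ): for CHARGED `W` the
`k`-fold `ℰp`-averages of `UkH k h W` equal `W` on the bonds of `Ω_k(h)` — while `ChargedT3` reads only the four-corner plaquettes of `Ω_k(h)` and says nothing about `W`'s holonomy
around a hole of `Ω_k(h)`. [cite: Balaban1985UV3, (38)–(42) p.266, (68) p.273; Balaban1985Variational, (2)–(3) p.278] -/
theorem AlphaInputsT3AC.plaqSmall_of_nestedRegularSel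
    {Ut : (k : ℕ) → GaugeField (F.P K) k (Matrix.specialUnitaryGroup (Fin 2) ℂ) → GaugeField (F.P K) 0 (Matrix.specialUnitaryGroup (Fin 2) ℂ)}
    {UkH : (k : ℕ) → Hist (F.P K) k → GaugeField (F.P K) k (Matrix.specialUnitaryGroup (Fin 2) ℂ) →
      GaugeField (F.P K) 0 (Matrix.specialUnitaryGroup (Fin 2) ℂ)}
    (hsel : AlphaInputsT3AC.NestedRegularSelT3 F 𝔠 γ hγ hγ1 K Ut UkH) {k : ℕ} (hk : k ≤ K) {h : Hist (F.P K) k}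
    (hh : Hist.Admissible 𝔠.lane.carrier.M₁ (rcolOf (T3Scales F γ hγ (hγ1.trans (sq_min_one_le _ 𝔠.gamma0_pos)) K) 𝔠.lane.carrier) k h)
    (hne : h ≠ Hist.triv (F.P K) k) (W : GaugeField (F.P K) k (Matrix.specialUnitaryGroup (Fin 2) ℂ)) :
    ∃ α₀ : ℝ, 0 < α₀ ∧ α₀ ≤ 𝔠.C68 * θBal F.L γ 𝔠.b₀ 𝔠.p₀ K ∧
      (143 * ((7 : ℝ) ^ 2 / 4) ^ 2) * ((F.L : ℝ) ^ 2 * α₀) ≤ 1 / 3 ∧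
      PlaqSmall α₀ (UkH k h W) ∧
      (ChargedT3 F γ 𝔠.b₀ 𝔠.p₀ (avgWindowFactor F.L) K 𝔠.lane.carrier.M₁
          (rcolOf (T3Scales F γ hγ (hγ1.trans (sq_min_one_le _ 𝔠.gamma0_pos)) K) 𝔠.lane.carrier) k h W →
        ∀ b : PBond (F.P K) k, b ∈ bondsIn k (Omega 𝔠.lane.carrier.M₁
            (rcolOf (T3Scales F γ hγ (hγ1.trans (sq_min_one_le _ 𝔠.gamma0_pos)) K) 𝔠.lane.carrier) k h k) →
          Averaging.iter (fun i => BlockAveraging.blockAvg (P := F.P K) (j := i) ℰp) k (UkH k h W) b = W b) := by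
  obtain ⟨-, -, hmem⟩ := hsel
  obtain ⟨α, 𝓥, hα, hsmall, hwin0, -, -, hU, -, -, htop⟩ := hmem k hk h hh hne W
  refine ⟨α 0, hα 0 (Nat.zero_le k), hwin0, (hsmall 0 (Nat.zero_le k)).1, ?_, htop⟩
  have h0 := hU 0 (Nat.zero_le k)
  rw [AlphaInputsT3AC.plaqSmallOn_Omega_zero_iff] at h0
  simpa using h0

end Nested

/-! ## §3 The regional carrier's clause 1 of (2) is global too -/

section Carrier

variable {F : T3Family} {𝔠 : AlphaConsts F.L (suGroupModel 2).N} {γ : ℝ} {hγ : 0 < γ} {hγ1 : γ ≤ (min 𝔠.gamma0 1) ^ 2} {K : ℕ}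

/-- **`RegOnT3 k h e U` ⇒ `PlaqSmall e U` ON THE WHOLE TORUS** (clause 1 of (2) at `j = 0`, `Ω₀(h) = T_η`; ✓ `plaqSmallOn_of_regOnT3`).  Print's (2) is stated for configurations on
its own `Ω₀ ⊊ T_η` (the first small-field region plus an `R₁M₁`-collar), where the frozen large-field cores are excised; the T³ carrier's `Ω₀ = T_η` makes clause 1 global — to be kept in
view for the B1 re-cut. [cite: Balaban1985Variational, (2) p.278; Balaban1985UV3, p.257 and (42) p.266] -/
theorem AlphaInputsT3AC.plaqSmall_of_regOnT3 {k : ℕ} {h : Hist (F.P K) k} {e : ℝ} {U : GaugeField (F.P K) 0 (Matrix.specialUnitaryGroup (Fin 2) ℂ)}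
    (hU : AlphaInputsT3AC.RegOnT3 F 𝔠 γ hγ hγ1 K k h e U) : PlaqSmall e U := by
  have h0 := AlphaInputsT3AC.plaqSmallOn_of_regOnT3 (hγ1 := hγ1) hU (Nat.zero_le k)
  rw [AlphaInputsT3AC.plaqSmallOn_Omega_zero_iff] at h0
  simpa using h0

/-- The same for every member of the regional regular fibre `regFibreRegT3 k h e 𝓥`. [cite: Balaban1985Variational, (6) p.278, (8) p.279] -/
theorem AlphaInputsT3AC.plaqSmall_of_mem_regFibreRegT3 {k : ℕ} {h : Hist (F.P K) k} {e : ℝ}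
    {𝓥 : (j : ℕ) → GaugeField (F.P K) j (Matrix.specialUnitaryGroup (Fin 2) ℂ)} {U : GaugeField (F.P K) 0 (Matrix.specialUnitaryGroup (Fin 2) ℂ)}
    (hU : U ∈ AlphaInputsT3AC.regFibreRegT3 F 𝔠 γ hγ hγ1 K k h e 𝓥) : PlaqSmall e U :=
  AlphaInputsT3AC.plaqSmall_of_regOnT3 hU.1

end Carrier

end Summit.QuantumFields.YangMills.Theorems

end
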